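import Summits.AtomisticToContinuum.HydrodynamicLimit.Theorems.RelayRaceLocalityLightConeInLawSVCLine
import Summits.AtomisticToContinuum.HydrodynamicLimit.Theorems.RelayRaceLocalityLightConeInLawStubSusceptibility

/-!
# The abstract chain lemma of the line `susceptibility-variance-continuity` (stub `stub_chain`)

Crux `LightConeInLaw` (stmt-AtomisticToContinuum-12500, route `RelayRaceLocality`), line
`susceptibility-variance-continuity`, registered stub `stub_chain` (rev 2: the ABSTRACT CHAIN LEMMA with explicit
bounds). Pure real analysis on an exponential family of weights on `ℕ`, in the vocabulary of
`RelayRaceLocalityLightConeInLawSVCLine` (`wZ w ν = Σ' wₙ νⁿ`, `wP w ν n = wₙ νⁿ / wZ w ν`,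
`wMean w g ν = Σ' wP w ν n · g n`): for weights `w ≥ 0`, `w 0 > 0`, `Σ wₙ rⁿ < ∞ (∀ r > 0)`, `|g| ≤ 1`, a window
`[lo, hi]` of mean counts and `L > 0`, IF the susceptibility identity holds for `w` (SUS), `Var(g) ≤ C/L` on the
window (VAR), `s₀ L ≤ Var(n) ≤ s₁ L` and the weight within `1` of the mean is `≥ c₀/√L` on the window (LCLT), and
`μ₁, μ₂ > 0` realise window integers `m₁, m₂` as mean counts, THEN
`|g m₁ − g m₂| ≤ 2 √(C / (c₀ √L)) + √(s₁ C) · |m₁ − m₂| / (s₀ L)`.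

Proof. Basics (`wZ > 0` and entire weighted generating functions from `…StubSusceptibility`): `Σ' wP = 1`,
absolute convergence of polynomially weighted means, the `tsum` forms of covariance and variance, and weighted
Cauchy–Schwarz `|Σ' p a b| ≤ √(Σ' p a²) √(Σ' p b²)` (discriminant of `t ↦ Σ' p (t a + b)² ≥ 0`). Extraction:
`p(m)(g m − ⟨g⟩)² ≤ Var(g) ≤ C/L` and `√L p(m) ≥ c₀`. Drift: in `s = log μ` the mean count has derivative
`Var(n) ≥ 0` (SUS + chain rule), so it is monotone and stays in the window on `[log μ₁, log μ₂]`, where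
`Var(n) ≥ s₀ L` gives `s₀ L (log μ₂ − log μ₁) ≤ M(μ₂) − M(μ₁)` (`Convex.mul_sub_le_image_sub_of_le_deriv`) and
`|d⟨g⟩/ds| = |Cov(n, g)| ≤ √Var(n) √Var(g) ≤ √(s₁ C)` (`Convex.norm_image_sub_le_of_norm_hasDerivWithin_le`);
triangle inequality. Sources: folklore (exponential families, fluctuation–response) and Mathlib's one-dimensional
mean value inequalities. Deliberately NOT here: measure theory, hard spheres, the limit `N → ∞` (the lead's glue).
-/


namespace Summit.AtomisticToContinuum.HydrodynamicLimit.Theorems.LightConeInLawSVC.Chain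

open Set Summit.AtomisticToContinuum.HydrodynamicLimit.Theorems.LightConeInLawSVC

noncomputable section

/-! ## Basics on the exponential family `wP` -/

/-- The family weights `wP w ν n` are nonnegative for `ν ≥ 0`. [folklore] -/
theorem wP_nonneg {w : ℕ → ℝ} (hw : ∀ n, 0 ≤ w n) {ν : ℝ} (hν : 0 ≤ ν) (n : ℕ) : 0 ≤ wP w ν n :=
  div_nonneg (mul_nonneg (hw n) (pow_nonneg hν n))
    (tsum_nonneg fun k => mul_nonneg (hw k) (pow_nonneg hν k))

/-- The family weights sum to one (`ν > 0`). [folklore] -/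
theorem tsum_wP {w : ℕ → ℝ} (hw : ∀ n, 0 ≤ w n) (hw0 : 0 < w 0)
    (hws : ∀ r : ℝ, 0 < r → Summable fun n => w n * r ^ n) {ν : ℝ} (hν : 0 < ν) :
    ∑' n, wP w ν n = 1 := by
  unfold wP
  rw [tsum_div_const]
  exact div_self (Susceptibility.wZ_pos hw hw0 hws hν).ne'

/-- Means of polynomially bounded sequences against the family converge absolutely (the weighted generating
function is entire: `Susceptibility.summable_abs_mul_pow`). [folklore] -/
theorem summable_wP_mul {w : ℕ → ℝ} (hw : ∀ n, 0 ≤ w n)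
    (hws : ∀ r : ℝ, 0 < r → Summable fun n => w n * r ^ n) {ν : ℝ} (hν : 0 < ν)
    {h : ℕ → ℝ} {B : ℝ} {k : ℕ} (hb : ∀ n, |h n| ≤ B * ((n : ℝ) + 1) ^ k) :
    Summable fun n => wP w ν n * h n := by
  have hs : Summable fun n => w n * ν ^ n * h n := by
    refine Summable.of_norm_bounded (Susceptibility.summable_abs_mul_pow hw hws ⟨B, k, hb⟩ ν hν) fun n => ?_
    rw [Real.norm_eq_abs, show w n * ν ^ n * h n = w n * h n * ν ^ n by ring, abs_mul (w n * h n),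
      abs_of_nonneg (pow_nonneg hν.le n)]
  refine (hs.div_const (wZ w ν)).congr fun n => ?_
  simp only [wP]
  ring

/-- Shifting a polynomially bounded sequence by a constant keeps it polynomially bounded. [folklore] -/
theorem polyBound_sub {h : ℕ → ℝ} {B : ℝ} {k : ℕ} (hb : ∀ n, |h n| ≤ B * ((n : ℝ) + 1) ^ k) (c : ℝ) :
    ∀ n, |h n - c| ≤ (B + |c|) * ((n : ℝ) + 1) ^ k := fun n => by
  have h1 : (1 : ℝ) ≤ ((n : ℝ) + 1) ^ k :=
    one_le_pow₀ (by linarith [(Nat.cast_nonneg n : (0 : ℝ) ≤ n)])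
  calc |h n - c| ≤ |h n| + |c| := abs_sub _ _
    _ ≤ B * ((n : ℝ) + 1) ^ k + |c| * ((n : ℝ) + 1) ^ k :=
        add_le_add (hb n) (le_mul_of_one_le_right (abs_nonneg c) h1)
    _ = (B + |c|) * ((n : ℝ) + 1) ^ k := by ring

/-- Products of polynomially bounded sequences are polynomially bounded. [folklore] -/
theorem polyBound_mul {h₁ h₂ : ℕ → ℝ} {B₁ B₂ : ℝ} {k₁ k₂ : ℕ}
    (hb₁ : ∀ n, |h₁ n| ≤ B₁ * ((n : ℝ) + 1) ^ k₁) (hb₂ : ∀ n, |h₂ n| ≤ B₂ * ((n : ℝ) + 1) ^ k₂) :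
    ∀ n, |h₁ n * h₂ n| ≤ B₁ * B₂ * ((n : ℝ) + 1) ^ (k₁ + k₂) := fun n => by
  rw [abs_mul, pow_add]
  calc |h₁ n| * |h₂ n| ≤ B₁ * ((n : ℝ) + 1) ^ k₁ * (B₂ * ((n : ℝ) + 1) ^ k₂) :=
        mul_le_mul (hb₁ n) (hb₂ n) (abs_nonneg _) ((abs_nonneg _).trans (hb₁ n))
    _ = B₁ * B₂ * (((n : ℝ) + 1) ^ k₁ * ((n : ℝ) + 1) ^ k₂) := by ring

/-- `tsum` form of the covariance of two polynomially bounded sequences under the family: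
`⟨h₁ h₂⟩ − ⟨h₁⟩ ⟨h₂⟩ = Σ' p (h₁ − ⟨h₁⟩) (h₂ − ⟨h₂⟩)`. [folklore] -/
theorem cov_eq_tsum {w : ℕ → ℝ} (hw : ∀ n, 0 ≤ w n) (hw0 : 0 < w 0)
    (hws : ∀ r : ℝ, 0 < r → Summable fun n => w n * r ^ n) {ν : ℝ} (hν : 0 < ν)
    {h₁ h₂ : ℕ → ℝ} {B₁ B₂ : ℝ} {k₁ k₂ : ℕ}
    (hb₁ : ∀ n, |h₁ n| ≤ B₁ * ((n : ℝ) + 1) ^ k₁) (hb₂ : ∀ n, |h₂ n| ≤ B₂ * ((n : ℝ) + 1) ^ k₂) :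
    wMean w (fun n => h₁ n * h₂ n) ν - wMean w h₁ ν * wMean w h₂ ν =
      ∑' n, wP w ν n * ((h₁ n - wMean w h₁ ν) * (h₂ n - wMean w h₂ ν)) := by
  have hS0 : Summable (wP w ν) := (hws ν hν).div_const (wZ w ν)
  have hS1 : Summable fun n => wP w ν n * h₁ n := summable_wP_mul hw hws hν hb₁
  have hS2 : Summable fun n => wP w ν n * h₂ n := summable_wP_mul hw hws hν hb₂
  have hS12 : Summable fun n => wP w ν n * (h₁ n * h₂ n) :=
    summable_wP_mul hw hws hν (polyBound_mul hb₁ hb₂)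
  have e1 : ∑' n, wP w ν n * h₁ n = wMean w h₁ ν := rfl
  have e2 : ∑' n, wP w ν n * h₂ n = wMean w h₂ ν := rfl
  have e12 : ∑' n, wP w ν n * (h₁ n * h₂ n) = wMean w (fun n => h₁ n * h₂ n) ν := rfl
  have expand : ∀ n, wP w ν n * ((h₁ n - wMean w h₁ ν) * (h₂ n - wMean w h₂ ν)) =
      wP w ν n * (h₁ n * h₂ n) - wMean w h₂ ν * (wP w ν n * h₁ n) -
        wMean w h₁ ν * (wP w ν n * h₂ n) + wMean w h₁ ν * wMean w h₂ ν * wP w ν n := fun n => by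
    ring
  rw [tsum_congr expand, ((hS12.sub (hS1.mul_left _)).sub (hS2.mul_left _)).tsum_add (hS0.mul_left _),
    (hS12.sub (hS1.mul_left _)).tsum_sub (hS2.mul_left _), hS12.tsum_sub (hS1.mul_left _),
    tsum_mul_left, tsum_mul_left, tsum_mul_left, tsum_wP hw hw0 hws hν, e1, e2, e12]
  ring

/-- `tsum` form of the variance of a polynomially bounded sequence under the family:
`⟨h²⟩ − ⟨h⟩² = Σ' p (h − ⟨h⟩)²`. [folklore] -/
theorem var_eq_tsum {w : ℕ → ℝ} (hw : ∀ n, 0 ≤ w n) (hw0 : 0 < w 0)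
    (hws : ∀ r : ℝ, 0 < r → Summable fun n => w n * r ^ n) {ν : ℝ} (hν : 0 < ν)
    {h : ℕ → ℝ} {B : ℝ} {k : ℕ} (hb : ∀ n, |h n| ≤ B * ((n : ℝ) + 1) ^ k) :
    wMean w (fun n => h n ^ 2) ν - wMean w h ν ^ 2 = ∑' n, wP w ν n * (h n - wMean w h ν) ^ 2 := by
  simp only [sq]
  exact cov_eq_tsum hw hw0 hws hν hb hb

/-- Centered products of polynomially bounded sequences have absolutely convergent means. [folklore] -/
theorem summable_wP_centered {w : ℕ → ℝ} (hw : ∀ n, 0 ≤ w n)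
    (hws : ∀ r : ℝ, 0 < r → Summable fun n => w n * r ^ n) {ν : ℝ} (hν : 0 < ν)
    {h₁ h₂ : ℕ → ℝ} {B₁ B₂ : ℝ} {k₁ k₂ : ℕ}
    (hb₁ : ∀ n, |h₁ n| ≤ B₁ * ((n : ℝ) + 1) ^ k₁) (hb₂ : ∀ n, |h₂ n| ≤ B₂ * ((n : ℝ) + 1) ^ k₂)
    (c₁ c₂ : ℝ) : Summable fun n => wP w ν n * ((h₁ n - c₁) * (h₂ n - c₂)) :=
  summable_wP_mul hw hws hν (polyBound_mul (polyBound_sub hb₁ c₁) (polyBound_sub hb₂ c₂))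

/-- Centered squares of a polynomially bounded sequence have absolutely convergent means. [folklore] -/
theorem summable_wP_centered_sq {w : ℕ → ℝ} (hw : ∀ n, 0 ≤ w n)
    (hws : ∀ r : ℝ, 0 < r → Summable fun n => w n * r ^ n) {ν : ℝ} (hν : 0 < ν)
    {h : ℕ → ℝ} {B : ℝ} {k : ℕ} (hb : ∀ n, |h n| ≤ B * ((n : ℝ) + 1) ^ k) (c : ℝ) :
    Summable fun n => wP w ν n * (h n - c) ^ 2 :=
  (summable_wP_centered hw hws hν hb hb c c).congr fun n => by ring

/-! ## A weighted Cauchy–Schwarz inequality -/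

/-- Discriminant form of Cauchy–Schwarz: if `A t² + 2 X t + B ≥ 0` for all real `t` and `A ≥ 0`, then
`|X| ≤ √A · √B`. [folklore] -/
theorem abs_le_sqrt_mul_sqrt_of_quad {A X B : ℝ} (hA : 0 ≤ A)
    (h : ∀ t : ℝ, 0 ≤ A * (t * t) + 2 * X * t + B) : |X| ≤ Real.sqrt A * Real.sqrt B := by
  have hd := discrim_le_zero h
  rw [discrim] at hd
  rw [← Real.sqrt_mul hA]
  exact Real.abs_le_sqrt (by nlinarith [hd])

/-- Weighted Cauchy–Schwarz for absolutely convergent means with nonnegative weights: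
`|Σ' p a b| ≤ √(Σ' p a²) · √(Σ' p b²)`. [folklore] -/
theorem abs_tsum_mul_le_sqrt {P a b : ℕ → ℝ} (hP : ∀ n, 0 ≤ P n) (ha : Summable fun n => P n * a n ^ 2)
    (hb : Summable fun n => P n * b n ^ 2) (hab : Summable fun n => P n * (a n * b n)) :
    |∑' n, P n * (a n * b n)| ≤ Real.sqrt (∑' n, P n * a n ^ 2) * Real.sqrt (∑' n, P n * b n ^ 2) := by
  refine abs_le_sqrt_mul_sqrt_of_quad (tsum_nonneg fun n => mul_nonneg (hP n) (sq_nonneg _)) fun t => ?_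
  have key : ∑' n, P n * (t * a n + b n) ^ 2 =
      (∑' n, P n * a n ^ 2) * (t * t) + 2 * (∑' n, P n * (a n * b n)) * t + ∑' n, P n * b n ^ 2 := by
    have e : ∀ n, P n * (t * a n + b n) ^ 2 =
        t * t * (P n * a n ^ 2) + 2 * t * (P n * (a n * b n)) + P n * b n ^ 2 := fun n => by ring
    rw [tsum_congr e, ((ha.mul_left (t * t)).add (hab.mul_left (2 * t))).tsum_add hb,
      (ha.mul_left (t * t)).tsum_add (hab.mul_left (2 * t)), tsum_mul_left, tsum_mul_left]
    ring
  rw [← key]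
  exact tsum_nonneg fun n => mul_nonneg (hP n) (sq_nonneg _)

/-! ## Derivatives along `s ↦ exp s` from the susceptibility identity -/

/-- Along `s ↦ eˢ` the mean count has derivative the count variance (the susceptibility identity SUS with
`g' = id` and the chain rule; the factor `eˢ` cancels `ν⁻¹`). [folklore] -/
theorem hasDerivAt_mean_exp {w : ℕ → ℝ}
    (hSUS : ∀ g' : ℕ → ℝ, (∃ B : ℝ, ∃ k : ℕ, ∀ n, |g' n| ≤ B * ((n : ℝ) + 1) ^ k) → ∀ ν : ℝ, 0 < ν →
        HasDerivAt (wMean w g')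
          (ν⁻¹ * (wMean w (fun n => (n : ℝ) * g' n) ν - wMean w (fun n => (n : ℝ)) ν * wMean w g' ν)) ν)
    (s : ℝ) :
    HasDerivAt (fun s => wMean w (fun n => (n : ℝ)) (Real.exp s))
      (wMean w (fun n => (n : ℝ) ^ 2) (Real.exp s) - wMean w (fun n => (n : ℝ)) (Real.exp s) ^ 2) s := by
  have hb : ∃ B : ℝ, ∃ k : ℕ, ∀ n : ℕ, |(n : ℝ)| ≤ B * ((n : ℝ) + 1) ^ k :=
    ⟨1, 1, fun n => by rw [Nat.abs_cast, one_mul, pow_one]; linarith⟩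
  have h := (hSUS (fun n => (n : ℝ)) hb (Real.exp s) (Real.exp_pos s)).comp s (Real.hasDerivAt_exp s)
  refine h.congr_deriv ?_
  simp only [← sq]
  field_simp

/-- Along `s ↦ eˢ` the family mean of a bounded `g` has derivative the covariance `⟨n g⟩ − ⟨n⟩⟨g⟩`
(SUS with `g' = g` and the chain rule). [folklore] -/
theorem hasDerivAt_gmean_exp {w g : ℕ → ℝ} (hg : ∀ n, |g n| ≤ 1)
    (hSUS : ∀ g' : ℕ → ℝ, (∃ B : ℝ, ∃ k : ℕ, ∀ n, |g' n| ≤ B * ((n : ℝ) + 1) ^ k) → ∀ ν : ℝ, 0 < ν →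
        HasDerivAt (wMean w g')
          (ν⁻¹ * (wMean w (fun n => (n : ℝ) * g' n) ν - wMean w (fun n => (n : ℝ)) ν * wMean w g' ν)) ν)
    (s : ℝ) :
    HasDerivAt (fun s => wMean w g (Real.exp s))
      (wMean w (fun n => (n : ℝ) * g n) (Real.exp s) -
        wMean w (fun n => (n : ℝ)) (Real.exp s) * wMean w g (Real.exp s)) s := by
  have hb : ∃ B : ℝ, ∃ k : ℕ, ∀ n : ℕ, |g n| ≤ B * ((n : ℝ) + 1) ^ k :=
    ⟨1, 0, fun n => by rw [pow_zero, mul_one]; exact hg n⟩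
  have h := (hSUS g hb (Real.exp s) (Real.exp_pos s)).comp s (Real.hasDerivAt_exp s)
  refine h.congr_deriv ?_
  field_simp

/-! ## Pointwise extraction and drift control -/

/-- Pointwise extraction: a variance bound `L · Var(g) ≤ C` and a lower bound `c₀ ≤ √L · p(m)` on one weight force
`|g m − ⟨g⟩| ≤ √(C / (c₀ √L))`, because `p(m) (g m − ⟨g⟩)² ≤ Σ' p (g − ⟨g⟩)² = Var(g)`. [folklore] -/
theorem extraction {w g : ℕ → ℝ} (hw : ∀ n, 0 ≤ w n) (hw0 : 0 < w 0)
    (hws : ∀ r : ℝ, 0 < r → Summable fun n => w n * r ^ n) (hg : ∀ n, |g n| ≤ 1)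
    {L C c₀ μ : ℝ} {m : ℕ} (hL : 0 < L) (hc₀ : 0 < c₀) (hμ : 0 < μ)
    (hV : L * (wMean w (fun n => g n ^ 2) μ - wMean w g μ ^ 2) ≤ C)
    (hp : c₀ ≤ Real.sqrt L * wP w μ m) :
    |g m - wMean w g μ| ≤ Real.sqrt (C / (c₀ * Real.sqrt L)) := by
  have hbg : ∀ n, |g n| ≤ 1 * ((n : ℝ) + 1) ^ 0 := fun n => by rw [pow_zero, mul_one]; exact hg n
  rw [var_eq_tsum hw hw0 hws hμ hbg] at hV
  have hterm : wP w μ m * (g m - wMean w g μ) ^ 2 ≤ ∑' n, wP w μ n * (g n - wMean w g μ) ^ 2 :=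
    (summable_wP_centered_sq hw hws hμ hbg (wMean w g μ)).le_tsum m
      fun j _ => mul_nonneg (wP_nonneg hw hμ.le j) (sq_nonneg _)
  have hsq : Real.sqrt L * Real.sqrt L = L := Real.mul_self_sqrt hL.le
  have h2 : c₀ * Real.sqrt L * (g m - wMean w g μ) ^ 2 ≤ C :=
    calc c₀ * Real.sqrt L * (g m - wMean w g μ) ^ 2
        ≤ Real.sqrt L * wP w μ m * Real.sqrt L * (g m - wMean w g μ) ^ 2 :=
          mul_le_mul_of_nonneg_right (mul_le_mul_of_nonneg_right hp (Real.sqrt_nonneg L)) (sq_nonneg _)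
      _ = Real.sqrt L * Real.sqrt L * (wP w μ m * (g m - wMean w g μ) ^ 2) := by ring
      _ = L * (wP w μ m * (g m - wMean w g μ) ^ 2) := by rw [hsq]
      _ ≤ C := (mul_le_mul_of_nonneg_left hterm hL.le).trans hV
  refine Real.abs_le_sqrt ?_
  rw [le_div_iff₀ (mul_pos hc₀ (Real.sqrt_pos.2 hL))]
  calc (g m - wMean w g μ) ^ 2 * (c₀ * Real.sqrt L) = c₀ * Real.sqrt L * (g m - wMean w g μ) ^ 2 := by ring
    _ ≤ C := h2

/-- Drift control between two ordered activities `0 < μ₁ ≤ μ₂` whose mean counts bracket a sub-window of `[lo, hi]`: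
in `s = log μ` the mean count is monotone with slope `V ≥ s₀ L` and the `g`-mean has slope `|Cov(n, g)| ≤ √(s₁ C)`
on the window, hence `|⟨g⟩(μ₁) − ⟨g⟩(μ₂)| ≤ √(s₁ C) · |M(μ₁) − M(μ₂)| / (s₀ L)`. [folklore] -/
theorem drift {w g : ℕ → ℝ} (hw : ∀ n, 0 ≤ w n) (hw0 : 0 < w 0)
    (hws : ∀ r : ℝ, 0 < r → Summable fun n => w n * r ^ n) (hg : ∀ n, |g n| ≤ 1)
    {lo hi L C c₀ s₀ s₁ μ₁ μ₂ : ℝ} (hL : 0 < L) (hs₀ : 0 < s₀)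
    (hSUS : ∀ g' : ℕ → ℝ, (∃ B : ℝ, ∃ k : ℕ, ∀ n, |g' n| ≤ B * ((n : ℝ) + 1) ^ k) → ∀ ν : ℝ, 0 < ν →
        HasDerivAt (wMean w g')
          (ν⁻¹ * (wMean w (fun n => (n : ℝ) * g' n) ν - wMean w (fun n => (n : ℝ)) ν * wMean w g' ν)) ν)
    (hVAR : ∀ μ : ℝ, 0 < μ → lo ≤ wMean w (fun n => (n : ℝ)) μ → wMean w (fun n => (n : ℝ)) μ ≤ hi →
        L * (wMean w (fun n => g n ^ 2) μ - wMean w g μ ^ 2) ≤ C)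
    (hLCLT : ∀ μ : ℝ, 0 < μ → lo ≤ wMean w (fun n => (n : ℝ)) μ → wMean w (fun n => (n : ℝ)) μ ≤ hi →
        s₀ * L ≤ wMean w (fun n => (n : ℝ) ^ 2) μ - wMean w (fun n => (n : ℝ)) μ ^ 2 ∧
        wMean w (fun n => (n : ℝ) ^ 2) μ - wMean w (fun n => (n : ℝ)) μ ^ 2 ≤ s₁ * L ∧
        ∀ n : ℕ, |(n : ℝ) - wMean w (fun n => (n : ℝ)) μ| ≤ 1 → c₀ ≤ Real.sqrt L * wP w μ n)
    (hμ₁ : 0 < μ₁) (h12 : μ₁ ≤ μ₂) (hlo : lo ≤ wMean w (fun n => (n : ℝ)) μ₁)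
    (hhi : wMean w (fun n => (n : ℝ)) μ₂ ≤ hi) :
    |wMean w g μ₁ - wMean w g μ₂| ≤
      Real.sqrt (s₁ * C) * |wMean w (fun n => (n : ℝ)) μ₁ - wMean w (fun n => (n : ℝ)) μ₂| / (s₀ * L) := by
  have hbid : ∀ n : ℕ, |(n : ℝ)| ≤ 1 * ((n : ℝ) + 1) ^ 1 := fun n => by
    rw [Nat.abs_cast, one_mul, pow_one]; linarith
  have hbg : ∀ n, |g n| ≤ 1 * ((n : ℝ) + 1) ^ 0 := fun n => by rw [pow_zero, mul_one]; exact hg n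
  have hdM := hasDerivAt_mean_exp hSUS
  have hdG := hasDerivAt_gmean_exp hg hSUS
  -- the mean count is monotone along `exp`
  have hmono : Monotone fun s => wMean w (fun n => (n : ℝ)) (Real.exp s) :=
    monotone_of_deriv_nonneg (fun s => (hdM s).differentiableAt) fun s => by
      rw [(hdM s).deriv, var_eq_tsum hw hw0 hws (Real.exp_pos s) hbid]
      exact tsum_nonneg fun n => mul_nonneg (wP_nonneg hw (Real.exp_pos s).le n) (sq_nonneg _)
  have hab : Real.log μ₁ ≤ Real.log μ₂ := Real.log_le_log hμ₁ h12
  have hμ₂ : 0 < μ₂ := hμ₁.trans_le h12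
  -- the window along the segment `[log μ₁, log μ₂]`
  have hwin : ∀ s ∈ Icc (Real.log μ₁) (Real.log μ₂),
      lo ≤ wMean w (fun n => (n : ℝ)) (Real.exp s) ∧ wMean w (fun n => (n : ℝ)) (Real.exp s) ≤ hi := by
    intro s hs
    have h1 : wMean w (fun n => (n : ℝ)) (Real.exp (Real.log μ₁)) ≤
        wMean w (fun n => (n : ℝ)) (Real.exp s) := hmono hs.1
    have h2 : wMean w (fun n => (n : ℝ)) (Real.exp s) ≤
        wMean w (fun n => (n : ℝ)) (Real.exp (Real.log μ₂)) := hmono hs.2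
    rw [Real.exp_log hμ₁] at h1
    rw [Real.exp_log hμ₂] at h2
    exact ⟨hlo.trans h1, h2.trans hhi⟩
  -- lower bound on the slope of the mean count
  have hMVT : s₀ * L * (Real.log μ₂ - Real.log μ₁) ≤
      wMean w (fun n => (n : ℝ)) (Real.exp (Real.log μ₂)) -
        wMean w (fun n => (n : ℝ)) (Real.exp (Real.log μ₁)) :=
    (convex_Icc (Real.log μ₁) (Real.log μ₂)).mul_sub_le_image_sub_of_le_deriv
      (fun x _ => (hdM x).continuousAt.continuousWithinAt)
      (fun x _ => (hdM x).differentiableAt.differentiableWithinAt)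
      (fun x hx => by
        rw [(hdM x).deriv]
        obtain ⟨h1, h2⟩ := hwin x (interior_subset hx)
        exact (hLCLT _ (Real.exp_pos x) h1 h2).1)
      (Real.log μ₁) (left_mem_Icc.2 hab) (Real.log μ₂) (right_mem_Icc.2 hab) hab
  rw [Real.exp_log hμ₁, Real.exp_log hμ₂] at hMVT
  -- bound on the slope of the `g`-mean on the segment
  have hbound : ∀ x ∈ Icc (Real.log μ₁) (Real.log μ₂),
      ‖wMean w (fun n => (n : ℝ) * g n) (Real.exp x) -
          wMean w (fun n => (n : ℝ)) (Real.exp x) * wMean w g (Real.exp x)‖ ≤ Real.sqrt (s₁ * C) := by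
    intro x hx
    obtain ⟨h1, h2⟩ := hwin x hx
    have hν := Real.exp_pos x
    obtain ⟨hV1, hV2, -⟩ := hLCLT _ hν h1 h2
    have hVg := hVAR _ hν h1 h2
    rw [Real.norm_eq_abs, cov_eq_tsum hw hw0 hws hν hbid hbg]
    rw [var_eq_tsum hw hw0 hws hν hbid] at hV1 hV2
    rw [var_eq_tsum hw hw0 hws hν hbg] at hVg
    have hs1L : 0 ≤ s₁ * L := (mul_pos hs₀ hL).le.trans (hV1.trans hV2)
    calc |∑' n, wP w (Real.exp x) n * (((n : ℝ) - wMean w (fun n => (n : ℝ)) (Real.exp x)) *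
            (g n - wMean w g (Real.exp x)))|
        ≤ Real.sqrt (∑' n, wP w (Real.exp x) n * ((n : ℝ) - wMean w (fun n => (n : ℝ)) (Real.exp x)) ^ 2) *
            Real.sqrt (∑' n, wP w (Real.exp x) n * (g n - wMean w g (Real.exp x)) ^ 2) :=
          abs_tsum_mul_le_sqrt (wP_nonneg hw hν.le) (summable_wP_centered_sq hw hws hν hbid _)
            (summable_wP_centered_sq hw hws hν hbg _) (summable_wP_centered hw hws hν hbid hbg _ _)
      _ ≤ Real.sqrt (s₁ * L) * Real.sqrt (C / L) :=
          mul_le_mul (Real.sqrt_le_sqrt hV2) (Real.sqrt_le_sqrt (by rwa [le_div_iff₀ hL, mul_comm]))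
            (Real.sqrt_nonneg _) (Real.sqrt_nonneg _)
      _ = Real.sqrt (s₁ * C) := by
          rw [← Real.sqrt_mul hs1L, mul_assoc, mul_div_cancel₀ _ hL.ne']
  have hGMVT : ‖wMean w g (Real.exp (Real.log μ₂)) - wMean w g (Real.exp (Real.log μ₁))‖ ≤
      Real.sqrt (s₁ * C) * ‖Real.log μ₂ - Real.log μ₁‖ :=
    Convex.norm_image_sub_le_of_norm_hasDerivWithin_le
      (fun x _ => (hdG x).hasDerivWithinAt) hbound (convex_Icc _ _)
      (left_mem_Icc.2 hab) (right_mem_Icc.2 hab)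
  rw [Real.exp_log hμ₁, Real.exp_log hμ₂, Real.norm_eq_abs, Real.norm_eq_abs,
    abs_of_nonneg (sub_nonneg.2 hab)] at hGMVT
  -- combine
  have hlog : Real.log μ₂ - Real.log μ₁ ≤
      |wMean w (fun n => (n : ℝ)) μ₁ - wMean w (fun n => (n : ℝ)) μ₂| / (s₀ * L) := by
    rw [le_div_iff₀ (mul_pos hs₀ hL), abs_sub_comm]
    calc (Real.log μ₂ - Real.log μ₁) * (s₀ * L) = s₀ * L * (Real.log μ₂ - Real.log μ₁) := by ring
      _ ≤ _ := hMVT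
      _ ≤ _ := le_abs_self _
  rw [abs_sub_comm]
  calc |wMean w g μ₂ - wMean w g μ₁| ≤ Real.sqrt (s₁ * C) * (Real.log μ₂ - Real.log μ₁) := hGMVT
    _ ≤ Real.sqrt (s₁ * C) *
          (|wMean w (fun n => (n : ℝ)) μ₁ - wMean w (fun n => (n : ℝ)) μ₂| / (s₀ * L)) :=
        mul_le_mul_of_nonneg_left hlog (Real.sqrt_nonneg _)
    _ = _ := by rw [mul_div_assoc]

/-! ## The registered stub -/

/-- **The abstract chain lemma** (registered stub `stub_chain` of the line `susceptibility-variance-continuity`,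
crux `LightConeInLaw`, rev 2). For weights `w ≥ 0`, `w 0 > 0`, `Σ wₙ rⁿ < ∞ (∀ r > 0)`, a sequence `|g| ≤ 1`, a
window `[lo, hi]` of mean counts, a scale `L > 0` and constants: IF the susceptibility identity holds for `w`
(SUS), the family variance of `g` is `≤ C/L` on the window (VAR), the count variance is two-sided
`s₀ L ≤ V ≤ s₁ L` and the weight near the mean is `≥ c₀/√L` on the window (LCLT), and two activities realise two
window integers `m₁, m₂` as mean counts, THEN `|g m₁ − g m₂| ≤ 2 √(C/(c₀ √L)) + √(s₁ C) · |m₁ − m₂| / (s₀ L)`.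
Proof: pointwise extraction at `μ₁` and `μ₂` (`extraction`), drift control in `log μ` (`drift`, either order of
the activities), triangle inequality. [folklore] -/
theorem stub_chain :
    ∀ (w g : ℕ → ℝ) (lo hi L C c₀ s₀ s₁ μ₁ μ₂ : ℝ) (m₁ m₂ : ℕ),
      (∀ n, 0 ≤ w n) → 0 < w 0 → (∀ r : ℝ, 0 < r → Summable fun n => w n * r ^ n) →
      (∀ n, |g n| ≤ 1) → 0 < L → 0 < c₀ → 0 < s₀ →
      (∀ g' : ℕ → ℝ, (∃ B : ℝ, ∃ k : ℕ, ∀ n, |g' n| ≤ B * ((n : ℝ) + 1) ^ k) → ∀ ν : ℝ, 0 < ν →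
        HasDerivAt (wMean w g')
          (ν⁻¹ * (wMean w (fun n => (n : ℝ) * g' n) ν - wMean w (fun n => (n : ℝ)) ν * wMean w g' ν)) ν) →
      (∀ μ : ℝ, 0 < μ → lo ≤ wMean w (fun n => (n : ℝ)) μ → wMean w (fun n => (n : ℝ)) μ ≤ hi →
        L * (wMean w (fun n => g n ^ 2) μ - wMean w g μ ^ 2) ≤ C) →
      (∀ μ : ℝ, 0 < μ → lo ≤ wMean w (fun n => (n : ℝ)) μ → wMean w (fun n => (n : ℝ)) μ ≤ hi →
        s₀ * L ≤ wMean w (fun n => (n : ℝ) ^ 2) μ - wMean w (fun n => (n : ℝ)) μ ^ 2 ∧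
        wMean w (fun n => (n : ℝ) ^ 2) μ - wMean w (fun n => (n : ℝ)) μ ^ 2 ≤ s₁ * L ∧
        ∀ n : ℕ, |(n : ℝ) - wMean w (fun n => (n : ℝ)) μ| ≤ 1 → c₀ ≤ Real.sqrt L * wP w μ n) →
      0 < μ₁ → 0 < μ₂ → wMean w (fun n => (n : ℝ)) μ₁ = m₁ → wMean w (fun n => (n : ℝ)) μ₂ = m₂ →
      lo ≤ (m₁ : ℝ) → (m₁ : ℝ) ≤ hi → lo ≤ (m₂ : ℝ) → (m₂ : ℝ) ≤ hi →
      |g m₁ - g m₂| ≤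
        2 * Real.sqrt (C / (c₀ * Real.sqrt L)) + Real.sqrt (s₁ * C) * |(m₁ : ℝ) - m₂| / (s₀ * L) := by
  intro w g lo hi L C c₀ s₀ s₁ μ₁ μ₂ m₁ m₂ hw hw0 hws hg hL hc₀ hs₀ hSUS hVAR hLCLT hμ₁ hμ₂ hM₁ hM₂
    hlo₁ hhi₁ hlo₂ hhi₂
  rw [← hM₁] at hlo₁ hhi₁
  rw [← hM₂] at hlo₂ hhi₂
  -- pointwise extraction at the two activities
  have hex₁ : |g m₁ - wMean w g μ₁| ≤ Real.sqrt (C / (c₀ * Real.sqrt L)) :=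
    extraction hw hw0 hws hg hL hc₀ hμ₁ (hVAR μ₁ hμ₁ hlo₁ hhi₁)
      ((hLCLT μ₁ hμ₁ hlo₁ hhi₁).2.2 m₁ (by rw [hM₁, sub_self, abs_zero]; exact zero_le_one))
  have hex₂ : |wMean w g μ₂ - g m₂| ≤ Real.sqrt (C / (c₀ * Real.sqrt L)) := by
    rw [abs_sub_comm]
    exact extraction hw hw0 hws hg hL hc₀ hμ₂ (hVAR μ₂ hμ₂ hlo₂ hhi₂)
      ((hLCLT μ₂ hμ₂ hlo₂ hhi₂).2.2 m₂ (by rw [hM₂, sub_self, abs_zero]; exact zero_le_one))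
  -- drift between the two activities (either order)
  have hdrift : |wMean w g μ₁ - wMean w g μ₂| ≤ Real.sqrt (s₁ * C) * |(m₁ : ℝ) - m₂| / (s₀ * L) := by
    rcases le_total μ₁ μ₂ with h | h
    · have := drift hw hw0 hws hg hL hs₀ hSUS hVAR hLCLT hμ₁ h hlo₁ hhi₂
      rwa [hM₁, hM₂] at this
    · have := drift hw hw0 hws hg hL hs₀ hSUS hVAR hLCLT hμ₂ h hlo₂ hhi₁
      rw [hM₁, hM₂] at this
      rwa [abs_sub_comm, abs_sub_comm (m₁ : ℝ)]
  -- triangle inequality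
  have htri : |g m₁ - g m₂| ≤
      |g m₁ - wMean w g μ₁| + |wMean w g μ₁ - wMean w g μ₂| + |wMean w g μ₂ - g m₂| :=
    (abs_sub_le (g m₁) (wMean w g μ₂) (g m₂)).trans
      (add_le_add (abs_sub_le (g m₁) (wMean w g μ₁) (wMean w g μ₂)) le_rfl)
  linarith [htri, hex₁, hex₂, hdrift]

end

end Summit.AtomisticToContinuum.HydrodynamicLimit.Theorems.LightConeInLawSVC.Chain
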